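import Summits.Ventures.HodgeRepro2.T5BergmanPairing
import Summits.Ventures.HodgeRepro2.DiscMeanValue

/-!
# The weighted Bergman space: pointwise control by the norm, and positive-definiteness

For `f` holomorphic on the disc with `∫_𝔻 |f|² (1 - |z|²)^{k-2} dA < ∞` (`k ≥ 2`) and `z ∈ 𝔻`, with
`ρ = (1 - |z|)/2`:

  `|f(z)|² ≤ (π ρ²)⁻¹ (1 - (|z| + ρ)²)^{-(k-2)} · ⟨f, f⟩_k`        (`norm_sq_le_pairing`)

— the area mean-value inequality `|f(z)|² ≤ (πρ²)⁻¹ ∫_{B(z,ρ)} |f|²` (p2's `DiscMeanValue.norm_sq_le_integral`)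
on the disc `B(z, ρ) ⊂ 𝔻`, where the weight `(1 - |w|²)^{k-2}` is bounded below by
`(1 - (|z| + ρ)²)^{k-2} > 0`.  Consequences:

* the evaluation functionals are bounded on the weighted Bergman space (the constant is locally bounded
  on `𝔻`), so `L²`-convergence in the pairing norm implies locally uniform convergence;
* **positive-definiteness**: `⟨f, f⟩_k = 0 ⇒ f = 0` on `𝔻` for holomorphic `f` (`eq_zero_of_pairing_self_eq_zero`).

These are the «positive-definiteness on the holomorphic functions» and «L² → sup control» items of the
explicit model's record; the completeness of the space is `T5BergmanComplete`.

Blind lane: Mathlib + the HodgeRepro2 prefix only (own files + p2's `DiscMeanValue`); no sorry;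
axioms ⊆ {propext, Classical.choice, Quot.sound}.
-/

namespace Summit.Ventures.HodgeRepro2.T5BergmanPointwise

open MeasureTheory Metric T5BergmanCoefficient T5BergmanPairing
open scoped Real

/-- The weight `(1 - |z|²)^{k-2}` of the weight-`k` pairing. -/
noncomputable abbrev weight (k : ℕ) (z : ℂ) : ℝ := (1 - ‖z‖ ^ 2) ^ (k - 2)

/-- The radius `ρ = (1 - |z|)/2` of the comparison disc at `z`. -/
noncomputable abbrev rad (z : ℂ) : ℝ := (1 - ‖z‖) / 2

/-- The pointwise constant `(π ρ²)⁻¹ (1 - (|z| + ρ)²)^{-(k-2)}`. -/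
noncomputable abbrev pointwiseConst (k : ℕ) (z : ℂ) : ℝ :=
  (π * rad z ^ 2)⁻¹ * ((1 - (‖z‖ + rad z) ^ 2) ^ (k - 2))⁻¹

/-! ### The comparison disc -/

/-- `ρ = (1 - |z|)/2 > 0` for `z ∈ 𝔻`. -/
lemma rad_pos {z : ℂ} (hz : z ∈ ball (0 : ℂ) 1) : 0 < rad z := by
  have := mem_ball_zero_iff.mp hz
  unfold rad
  linarith

/-- `|z| + ρ = (1 + |z|)/2 < 1` for `z ∈ 𝔻`. -/
lemma norm_add_rad_lt_one {z : ℂ} (hz : z ∈ ball (0 : ℂ) 1) : ‖z‖ + rad z < 1 := by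
  have := mem_ball_zero_iff.mp hz
  unfold rad
  linarith

/-- `closedBall z ρ ⊆ 𝔻`. -/
lemma closedBall_rad_subset {z : ℂ} (hz : z ∈ ball (0 : ℂ) 1) :
    closedBall z (rad z) ⊆ ball (0 : ℂ) 1 := by
  apply closedBall_subset_ball'
  rw [dist_zero_right]
  linarith [norm_add_rad_lt_one hz]

/-- On `closedBall z ρ` the weight is bounded below: `(1 - |w|²)^{k-2} ≥ (1 - (|z| + ρ)²)^{k-2}`. -/
lemma weight_ge_of_mem_closedBall (k : ℕ) {z w : ℂ} (hz : z ∈ ball (0 : ℂ) 1)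
    (hw : w ∈ closedBall z (rad z)) :
    (1 - (‖z‖ + rad z) ^ 2) ^ (k - 2) ≤ weight k w := by
  have h1 : ‖w‖ ≤ ‖z‖ + rad z := by
    have := mem_closedBall_iff_norm.mp hw
    calc ‖w‖ = ‖(w - z) + z‖ := by ring_nf
      _ ≤ ‖w - z‖ + ‖z‖ := norm_add_le _ _
      _ ≤ ‖z‖ + rad z := by linarith
  have h2 : 0 ≤ 1 - (‖z‖ + rad z) ^ 2 := by
    have h3 := norm_add_rad_lt_one hz
    have h4 : 0 ≤ ‖z‖ + rad z := by linarith [norm_nonneg z, rad_pos hz]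
    nlinarith
  apply pow_le_pow_left₀ h2
  have h5 : 0 ≤ ‖w‖ := norm_nonneg w
  nlinarith

/-- The lower bound `(1 - (|z| + ρ)²)^{k-2}` of the weight on the comparison disc is positive. -/
lemma weight_lower_pos (k : ℕ) {z : ℂ} (hz : z ∈ ball (0 : ℂ) 1) :
    0 < (1 - (‖z‖ + rad z) ^ 2) ^ (k - 2) := by
  apply pow_pos
  have h3 := norm_add_rad_lt_one hz
  have h4 : 0 ≤ ‖z‖ + rad z := by linarith [norm_nonneg z, rad_pos hz]
  nlinarith

/-- The pointwise constant is positive on `𝔻`. -/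
lemma pointwiseConst_pos (k : ℕ) {z : ℂ} (hz : z ∈ ball (0 : ℂ) 1) : 0 < pointwiseConst k z := by
  unfold pointwiseConst
  have := rad_pos hz
  have := weight_lower_pos k hz
  positivity

/-! ### The pointwise bound -/

/-- **Pointwise control by the weighted `L²`-norm**: for `f` holomorphic on `𝔻` with
`|f|² (1 - |z|²)^{k-2}` integrable on `𝔻`, and `z ∈ 𝔻`,
`|f(z)|² ≤ (π ρ²)⁻¹ (1 - (|z| + ρ)²)^{-(k-2)} · ∫_𝔻 |f|² (1 - |w|²)^{k-2} dA`, `ρ = (1 - |z|)/2`. -/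
theorem norm_sq_le_integral (k : ℕ) (f : ℂ → ℂ) (hf : DifferentiableOn ℂ f (ball 0 1))
    (hint : IntegrableOn (fun w => ‖f w‖ ^ 2 * weight k w) (ball (0 : ℂ) 1)) {z : ℂ}
    (hz : z ∈ ball (0 : ℂ) 1) :
    ‖f z‖ ^ 2 ≤ pointwiseConst k z * ∫ w in ball (0 : ℂ) 1, ‖f w‖ ^ 2 * weight k w := by
  set ρ : ℝ := rad z with hρ
  have hρ0 : 0 < ρ := rad_pos hz
  set c : ℝ := (1 - (‖z‖ + ρ) ^ 2) ^ (k - 2) with hc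
  have hc0 : 0 < c := weight_lower_pos k hz
  have hsub : closedBall z ρ ⊆ ball (0 : ℂ) 1 := closedBall_rad_subset hz
  -- the area mean-value inequality on `B(z, ρ)`
  have hd : DiffContOnCl ℂ f (ball z ρ) := by
    apply DifferentiableOn.diffContOnCl
    rw [closure_ball z hρ0.ne']
    exact hf.mono hsub
  have h1 : ‖f z‖ ^ 2 ≤ (π * ρ ^ 2)⁻¹ * ∫ w in ball z ρ, ‖f w‖ ^ 2 :=
    DiscMeanValue.norm_sq_le_integral hd hρ0
  -- `|f|² ≤ c⁻¹ |f|² w` on `B(z, ρ)`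
  have hfc : ContinuousOn f (closedBall z ρ) := (hf.mono hsub).continuousOn
  have hi1 : IntegrableOn (fun w => ‖f w‖ ^ 2) (ball z ρ) :=
    (((hfc.norm).pow 2).integrableOn_compact (isCompact_closedBall z ρ)).mono_set ball_subset_closedBall
  have hi2 : IntegrableOn (fun w => c⁻¹ * (‖f w‖ ^ 2 * weight k w)) (ball z ρ) :=
    (hint.mono_set (ball_subset_closedBall.trans hsub)).const_mul _
  have h2 : ∫ w in ball z ρ, ‖f w‖ ^ 2 ≤ ∫ w in ball z ρ, c⁻¹ * (‖f w‖ ^ 2 * weight k w) := by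
    apply setIntegral_mono_on hi1 hi2 measurableSet_ball
    intro w hw
    have hwc : c ≤ weight k w := weight_ge_of_mem_closedBall k hz (ball_subset_closedBall hw)
    have : ‖f w‖ ^ 2 * c ≤ ‖f w‖ ^ 2 * weight k w := by
      apply mul_le_mul_of_nonneg_left hwc (by positivity)
    rw [mul_comm c⁻¹, ← div_eq_mul_inv, le_div_iff₀ hc0]
    exact this
  -- enlarge `B(z, ρ)` to `𝔻`
  have h3 : ∫ w in ball z ρ, ‖f w‖ ^ 2 * weight k w ≤ ∫ w in ball (0 : ℂ) 1, ‖f w‖ ^ 2 * weight k w := by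
    apply setIntegral_mono_set hint
    · rw [Filter.EventuallyLE, ae_restrict_iff' measurableSet_ball]
      exact Filter.Eventually.of_forall fun w hw => by
        have := mem_ball_zero_iff.mp hw
        have h0 : 0 ≤ 1 - ‖w‖ ^ 2 := by nlinarith [norm_nonneg w]
        unfold weight
        positivity
    · exact Filter.Eventually.of_forall (ball_subset_closedBall.trans hsub)
  calc ‖f z‖ ^ 2 ≤ (π * ρ ^ 2)⁻¹ * ∫ w in ball z ρ, ‖f w‖ ^ 2 := h1
    _ ≤ (π * ρ ^ 2)⁻¹ * ∫ w in ball z ρ, c⁻¹ * (‖f w‖ ^ 2 * weight k w) :=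
        mul_le_mul_of_nonneg_left h2 (by positivity)
    _ = (π * ρ ^ 2)⁻¹ * c⁻¹ * ∫ w in ball z ρ, ‖f w‖ ^ 2 * weight k w := by
        rw [integral_const_mul]; ring
    _ ≤ (π * ρ ^ 2)⁻¹ * c⁻¹ * ∫ w in ball (0 : ℂ) 1, ‖f w‖ ^ 2 * weight k w :=
        mul_le_mul_of_nonneg_left h3 (by positivity)

/-- **Pointwise control by the pairing norm**: `|f(z)|² ≤ pointwiseConst k z · ⟨f, f⟩_k` for `f` holomorphic
on `𝔻` with integrable `|f|² (1 - |w|²)^{k-2}`. -/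
theorem norm_sq_le_pairing (k : ℕ) (f : ℂ → ℂ) (hf : DifferentiableOn ℂ f (ball 0 1))
    (hint : IntegrableOn (fun w => ‖f w‖ ^ 2 * weight k w) (ball (0 : ℂ) 1)) {z : ℂ}
    (hz : z ∈ ball (0 : ℂ) 1) :
    ‖f z‖ ^ 2 ≤ pointwiseConst k z * (pairing k f f).re := by
  rw [pairing_self_eq, Complex.ofReal_re]
  exact norm_sq_le_integral k f hf hint hz

/-- **Positive-definiteness on the holomorphic functions**: `⟨f, f⟩_k = 0 ⇒ f = 0` on `𝔻`. -/
theorem eq_zero_of_pairing_self_eq_zero (k : ℕ) (f : ℂ → ℂ) (hf : DifferentiableOn ℂ f (ball 0 1))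
    (hint : IntegrableOn (fun w => ‖f w‖ ^ 2 * weight k w) (ball (0 : ℂ) 1))
    (h0 : pairing k f f = 0) {z : ℂ} (hz : z ∈ ball (0 : ℂ) 1) : f z = 0 := by
  have := norm_sq_le_pairing k f hf hint hz
  rw [h0, Complex.zero_re, mul_zero] at this
  have h1 : ‖f z‖ ^ 2 = 0 := le_antisymm this (by positivity)
  simpa using h1

/-- `⟨f, f⟩_k = 0 ⟺ f = 0` on `𝔻`, for holomorphic `f` in the space. -/
theorem pairing_self_eq_zero_iff (k : ℕ) (f : ℂ → ℂ) (hf : DifferentiableOn ℂ f (ball 0 1))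
    (hint : IntegrableOn (fun w => ‖f w‖ ^ 2 * weight k w) (ball (0 : ℂ) 1)) :
    pairing k f f = 0 ↔ ∀ z ∈ ball (0 : ℂ) 1, f z = 0 := by
  refine ⟨fun h0 z hz => eq_zero_of_pairing_self_eq_zero k f hf hint h0 hz, fun h => ?_⟩
  unfold pairing
  apply setIntegral_eq_zero_of_forall_eq_zero
  intro z hz
  rw [h z hz]
  simp

/-! ### Uniformity on compact discs -/

/-- The uniform constant on `|z| ≤ r < 1`: `(π ((1-r)/2)²)⁻¹ (1 - ((1+r)/2)²)^{-(k-2)}`. -/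
noncomputable abbrev unifConst (k : ℕ) (r : ℝ) : ℝ :=
  (π * ((1 - r) / 2) ^ 2)⁻¹ * ((1 - ((1 + r) / 2) ^ 2) ^ (k - 2))⁻¹

/-- `pointwiseConst k z ≤ unifConst k r` for `|z| ≤ r < 1`: the pointwise constant is bounded on
compact discs, so `L²`-control gives UNIFORM control on `|z| ≤ r`. -/
theorem pointwiseConst_le (k : ℕ) {r : ℝ} (hr : r < 1) {z : ℂ} (hzr : ‖z‖ ≤ r) :
    pointwiseConst k z ≤ unifConst k r := by
  have hz0 : 0 ≤ ‖z‖ := norm_nonneg z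
  have hr0 : 0 ≤ r := hz0.trans hzr
  have hρ : (1 - r) / 2 ≤ rad z := by unfold rad; linarith
  have hρ0 : 0 < (1 - r) / 2 := by linarith
  have hs : ‖z‖ + rad z ≤ (1 + r) / 2 := by unfold rad; linarith
  have hs0 : 0 ≤ ‖z‖ + rad z := by unfold rad; linarith
  have hsr : (1 + r) / 2 < 1 := by linarith
  have h1 : 1 - ((1 + r) / 2) ^ 2 ≤ 1 - (‖z‖ + rad z) ^ 2 := by
    have := pow_le_pow_left₀ hs0 hs 2
    linarith
  have h1pos : 0 < 1 - ((1 + r) / 2) ^ 2 := by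
    have h2 : 0 ≤ (1 + r) / 2 := by linarith
    nlinarith
  unfold pointwiseConst unifConst
  apply mul_le_mul
  · apply inv_anti₀ (by positivity)
    apply mul_le_mul_of_nonneg_left _ Real.pi_pos.le
    exact pow_le_pow_left₀ hρ0.le hρ 2
  · apply inv_anti₀ (by positivity)
    exact pow_le_pow_left₀ h1pos.le h1 _
  · exact (inv_pos.mpr (weight_lower_pos k (mem_ball_zero_iff.mpr (hzr.trans_lt hr)))).le
  · positivity

/-- **Uniform control on compact discs**: `|f(z)|² ≤ unifConst k r · ⟨f, f⟩_k` for `|z| ≤ r < 1`. -/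
theorem norm_sq_le_pairing_of_norm_le (k : ℕ) (f : ℂ → ℂ) (hf : DifferentiableOn ℂ f (ball 0 1))
    (hint : IntegrableOn (fun w => ‖f w‖ ^ 2 * weight k w) (ball (0 : ℂ) 1)) {r : ℝ} (hr : r < 1)
    {z : ℂ} (hzr : ‖z‖ ≤ r) :
    ‖f z‖ ^ 2 ≤ unifConst k r * (pairing k f f).re := by
  have hz : z ∈ ball (0 : ℂ) 1 := mem_ball_zero_iff.mpr (hzr.trans_lt hr)
  calc ‖f z‖ ^ 2 ≤ pointwiseConst k z * (pairing k f f).re := norm_sq_le_pairing k f hf hint hz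
    _ ≤ unifConst k r * (pairing k f f).re :=
        mul_le_mul_of_nonneg_right (pointwiseConst_le k hr hzr) (pairing_self_nonneg k f).1

end Summit.Ventures.HodgeRepro2.T5BergmanPointwise
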